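import Mathlib
import HarnessLib
import Summits.Langlands.Langlands.Theses.SkinnerWilesDefectOne
import Summits.Langlands.Langlands.Theorems.SkinnerWilesDefectOneReducibleOrdinaryProModularDefs
import Summits.Langlands.Langlands.Theorems.SkinnerWilesDefectOneReducibleOrdinaryProModularFineSelmerDefs
import Summits.Langlands.Langlands.Theorems.SkinnerWilesDefectOneReducibleOrdinaryProModularOrientedSteinbergDatumAlgebraAux
import Summits.Langlands.Langlands.Theorems.SkinnerWilesDefectOneReducibleOrdinaryProModularSeedPatchingPrime
import Summits.Langlands.Langlands.Theorems.SkinnerWilesDefectOneReducibleOrdinaryProModularSeedPatchingPrimeResidueRestrict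
import Literature.NumberTheory.GaloisRepresentations.NearlyOrdinaryDeformationRing
import Literature.NumberTheory.GaloisRepresentations.PadicIntermediateFieldIntegers
import Literature.NumberTheory.GaloisRepresentations.OrdinaryGaloisRep

/-!
# Stub (P2) `stub_seedPatchingPrime`, lattice level: an `𝒪_L`-lattice of residual type `M.𝒟` is a type-`𝒟` point

Route `SkinnerWilesDefectOne`, crux `ReducibleOrdinaryProModular` (stmt-Langlands-12919), line
`fine-selmer-codimension-two`, stub (P2) `stub_seedPatchingPrime`.  Sequel of `…SeedPatchingPrime.lean`
(`stub_seedPatchingPrime_auxOfTypeD`: (P2) for every model `M` of which the seed's `r` is a type-`M.𝒟` point,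
i.e. a deformation of type `M.𝒟` over a TEST RING of the interface `NearlyOrdinaryDeformationRing`) and of
`…SeedPatchingPrimeResidueRestrict.lean` (Mazur's coefficient ring `A = 𝒪_L ×_{k_L} k` with residue field `k`).
This file brings the hypothesis down to LATTICES, the objects a Galois-theoretic proof of the remaining transport
actually produces ([SW, §4.4]; [Mazur, §10]):

* `exists_gl_map_eq` — descent of an invertible matrix along an injective ring map (entries of `Q`, `Q⁻¹` in the
  image);
* `isAdicContinuous_of_le` — adic continuity from a cofinal family of open kernels `ker (ρ mod J_m)`, `J_m ≤ 𝔪^m`;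
* `isOpen_ker_mod_comap_pow`, `isAdicContinuous_of_conj` — for `ρ_A : Γ_F → GL₂(A)`, `A ⊆ 𝒪_L`, pushed to a
  conjugate of a CONTINUOUS `r : Γ_F → GL₂(ℚ̄_p)`, the kernels modulo `𝔪_L^{m+1} ∩ A` are open (a closed = open
  ultrametric norm condition, landed `OrientedDatum.isOpen_ker_map_comp`), hence `ρ_A` is `𝔪_A`-adically
  continuous (`𝔪_L^{m+1} ∩ A ⊆ 𝔪_A^m`): CONTINUITY IS AUTOMATIC;
* `exists_isDeformation_of_lattice` — **an `𝒪_L`-lattice `r_L` of `r` whose reduction is `κ ∘ ρ̄_𝒟` on the nose,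
  unramified outside `𝒟.S`, upper triangular at `v ∣ p` in frames `≡ κ(𝒟.frame v)`, with compatible coefficient
  maps `ι : 𝒪 → 𝒪_L`, `κ : k → k_L`, descends to a deformation OF TYPE `𝒟` over `A = 𝒪_L ×_{k_L} k`** (an
  `𝒪`-algebra through `ι`, augmentation `κ⁻¹ ∘ residue` onto `k`), pushed by `A ⊆ 𝒪_L` to the same conjugate of
  `r` — exactly the hypothesis of `stub_seedPatchingPrime_auxOfTypeD`;
* `isUnramifiedAt_of_seedData`, `isUnramifiedAt_lattice_of_seedData` — LEVEL CONTROL: the seed's `r` (hence any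
  lattice of it) is unramified outside `S♯ ∪ {q} = M.𝒟.S` (`SeedData`'s level clause + the integral model
  `ρ₀ ↦ ρ` + `r` associated with a point of `𝕋(𝒰)`);
* the registered sub-goal `stub_seedPatchingPrime_auxOfLattice` — (P2)'s registered signature verbatim with ONE
  extra hypothesis: an `𝒪_L`-lattice of `r` of residual type `M.𝒟` (reduction `κ ∘ ρ̄_{M.𝒟}`, frames
  `≡ κ(M.𝒟.frame v)` at `v ∣ p`, coefficient maps `ι, κ`); unramifiedness is NOT assumed (it is derived).

After this file, (P2) as registered = this theorem + the purely RESIDUAL statement that the seed's `r` admits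
such a lattice for the model's datum — Skinner–Wiles' transport of the extension class between admissible data
[SW, Prop. 4.2] (open at `l₀ = 1`; Berger–Klosin residual uniqueness in the unique-class regime).

References: C. M. Skinner, A. J. Wiles, *Residually reducible representations and modular forms*, Publ. Math.
IHÉS 89 (1999), §2.1, §4.4 [SkinnerWiles1999]; B. Mazur, *An introduction to the deformation theory of Galois
representations* (1997), §2, §10 [Mazur1997Deformation].
-/

set_option linter.dupNamespace false -- project-wide option (lakefile weak.linter.dupNamespace); `Summit.Langlands.Langlands` is the mandated namespace
set_option autoImplicit false

namespace Summit.Langlands.Langlands.Cruxes.ReducibleOrdinaryProModular.FineSelmerCodimensionTwo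

open scoped NumberField MatrixGroups
open Filter NumberField IsDedekindDomain Field Matrix IsLocalRing
open Literature.NumberTheory.Automorphic Literature.NumberTheory.Automorphic.BigHeckeGLn
open Literature.NumberTheory.GaloisRepresentations
open Summit.Langlands.Langlands.Theses.SkinnerWilesDefectOne
open Summit.Langlands.Langlands.Cruxes.ReducibleOrdinaryProModular.SteinbergHyperplane

noncomputable section

/-! ## 1. Descent of an invertible matrix along an injective ring map -/

/-- **Descent of an invertible matrix**: if the entries of `Q` and of `Q⁻¹` lie in the image of the injective
`f : A → B`, then `Q = GL_n(f)(Q₀)` for some `Q₀ ∈ GL_n(A)`. [folklore] -/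
theorem exists_gl_map_eq {A B : Type*} [CommRing A] [CommRing B] (f : A →+* B) (hf : Function.Injective f)
    {n : ℕ} (Q : GL (Fin n) B) (h : ∀ i j, Q.val i j ∈ f.range) (h' : ∀ i j, (Q⁻¹).val i j ∈ f.range) :
    ∃ Q₀ : GL (Fin n) A, Matrix.GeneralLinearGroup.map f Q₀ = Q := by
  classical
  have hmapinj : Function.Injective fun M : Matrix (Fin n) (Fin n) A => M.map f :=
    fun M N hMN => Matrix.ext fun i j => hf (congrFun (congrFun hMN i) j)
  let X : Matrix (Fin n) (Fin n) A := Matrix.of fun i j => (h i j).choose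
  let Y : Matrix (Fin n) (Fin n) A := Matrix.of fun i j => (h' i j).choose
  have hX : X.map f = Q.val := Matrix.ext fun i j => (h i j).choose_spec
  have hY : Y.map f = (Q⁻¹).val := Matrix.ext fun i j => (h' i j).choose_spec
  have h1 : (1 : Matrix (Fin n) (Fin n) A).map f = 1 := Matrix.map_one f (map_zero f) (map_one f)
  have hXY : X * Y = 1 := hmapinj (by
    change (X * Y).map f = (1 : Matrix (Fin n) (Fin n) A).map f
    rw [Matrix.map_mul, hX, hY, h1, ← Units.val_mul, mul_inv_cancel, Units.val_one])
  have hYX : Y * X = 1 := hmapinj (by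
    change (Y * X).map f = (1 : Matrix (Fin n) (Fin n) A).map f
    rw [Matrix.map_mul, hX, hY, h1, ← Units.val_mul, inv_mul_cancel, Units.val_one])
  exact ⟨⟨X, Y, hXY, hYX⟩, Units.ext hX⟩

/-- **Adic continuity from a cofinal family of open kernels** (generic): if `J_m ≤ 𝔪_A^m` and every
`ker (ρ mod J_m)` is open, then `ρ` is `𝔪_A`-adically continuous (`ker (ρ mod J_m) ≤ ker (ρ mod 𝔪_A^m)`).
[cite: Mazur1997Deformation, §2] -/
theorem isAdicContinuous_of_le {Γ : Type*} [Group Γ] [TopologicalSpace Γ] [IsTopologicalGroup Γ] {n : ℕ}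
    {A : Type*} [CommRing A] [IsLocalRing A] (ρ : Γ →* GL (Fin n) A) (J : ℕ → Ideal A)
    (hJ : ∀ m, J m ≤ maximalIdeal A ^ m)
    (hopen : ∀ m, IsOpen ((((Matrix.GeneralLinearGroup.map (Ideal.Quotient.mk (J m))).comp ρ).ker : Set Γ))) :
    Deformation.IsAdicContinuous ρ := by
  intro m
  refine Subgroup.isOpen_mono (fun g hg => ?_) (hopen m)
  have hg' : Matrix.GeneralLinearGroup.map (Ideal.Quotient.mk (J m)) (ρ g) = 1 := (MonoidHom.mem_ker).1 hg
  refine (MonoidHom.mem_ker).2 ?_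
  change Matrix.GeneralLinearGroup.map (Ideal.Quotient.mk (maximalIdeal A ^ m)) (ρ g) = 1
  rw [← Ideal.Quotient.factor_comp_mk (hJ m), Matrix.GeneralLinearGroup.map_comp, MonoidHom.comp_apply, hg', map_one]

/-! ## 2. An `𝒪_L`-lattice reducing into `κ(k)` is a deformation of type `𝒟` over `𝒪_L ×_{k_L} k` -/

section Lattice

variable {F : Type} [Field F] [NumberField F] {p : ℕ} [Fact p.Prime]
variable {𝒪 : Type} [CommRing 𝒪] {k : Type} [Field k] [Algebra 𝒪 k]
variable (L : IntermediateField ℚ_[p] (PadicAlgCl p)) [FiniteDimensional ℚ_[p] L]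

omit [NumberField F] in
/-- **Kernels modulo `𝔪_L^{m+1} ∩ A` are open.**  For `ρ_A : Γ_F → GL₂(A)`, `A = 𝒪_L ×_{k_L} k`, whose
push-forward to `GL₂(ℚ̄_p)` is a conjugate of the continuous `r`, the kernel of `ρ_A mod (𝔪_L^{m+1} ∩ A)` is open:
membership is the closed — hence open, `ℚ̄_p` being ultrametric — norm condition `‖entry − δ‖ ≤ ‖ϖ_L‖^{m+1}` on the
entries of `P⁻¹ r P` (landed `OrientedDatum.isOpen_ker_map_comp`). [folklore] -/
theorem isOpen_ker_mod_comap_pow (A : Subring (intermediateFieldIntegers p L)) (rA : absoluteGaloisGroup F →* GL (Fin 2) A)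
    (r : FramedGaloisRep F (PadicAlgCl p) 2) (P : GL (Fin 2) (PadicAlgCl p))
    (hconj : ∀ g, Matrix.GeneralLinearGroup.map
      (((algebraMap L (PadicAlgCl p)).comp (intermediateFieldIntegers p L).subtype).comp A.subtype) (rA g) =
        P⁻¹ * r g * P) (m : ℕ) :
    IsOpen ((((Matrix.GeneralLinearGroup.map (Ideal.Quotient.mk
        ((maximalIdeal (intermediateFieldIntegers p L) ^ (m + 1)).comap A.subtype))).comp rA).ker :
          Set (absoluteGaloisGroup F))) := by
  have hcontr : ∀ i j, Continuous fun g => (P⁻¹ * r g * P).val i j := fun i j =>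
    (Units.continuous_val.comp ((continuous_const.mul (map_continuous r)).mul continuous_const)).matrix_elem i j
  have hU : IsOpen (Metric.closedBall (0 : PadicAlgCl p) (‖(intermediateFieldIntegers.uniformizer L : L)‖ ^ (m + 1))) :=
    IsUltrametricDist.isOpen_closedBall _ (pow_ne_zero _ (intermediateFieldIntegers.norm_uniformizer_pos L).ne')
  refine OrientedDatum.isOpen_ker_map_comp
    (((algebraMap L (PadicAlgCl p)).comp (intermediateFieldIntegers p L).subtype).comp A.subtype)
    (Ideal.Quotient.mk _) _ hU (fun y => ?_) rA (fun g => (P⁻¹ * r g * P).val) hcontr (fun g i j => ?_)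
  · rw [Ideal.Quotient.eq_zero_iff_mem, Ideal.mem_comap, intermediateFieldIntegers.mem_maximalIdeal_pow_iff,
      Metric.mem_closedBall, dist_zero_right]
    rfl
  · rw [← hconj g]
    rfl

omit [NumberField F] in
/-- **Automatic continuity of the descended lattice**: with notation as in `isOpen_ker_mod_comap_pow`, `ρ_A` is
`𝔪_A`-adically continuous, because `𝔪_L^{m+1} ∩ A ⊆ 𝔪_A^m` (`ResidueRestrict.mem_pow_of_coe_mem_pow_succ`).
[cite: Mazur1997Deformation, §2] -/
theorem isAdicContinuous_of_conj {k : Type} [Field k]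
    (κ : k →+* IsLocalRing.ResidueField (intermediateFieldIntegers p L)) {A : Subring (intermediateFieldIntegers p L)}
    (hA : ∀ a : (intermediateFieldIntegers p L), a ∈ A ↔ ∃ y : k, κ y = residue (intermediateFieldIntegers p L) a)
    (rA : absoluteGaloisGroup F →* GL (Fin 2) A)
    (r : FramedGaloisRep F (PadicAlgCl p) 2) (P : GL (Fin 2) (PadicAlgCl p))
    (hconj : ∀ g, Matrix.GeneralLinearGroup.map
      (((algebraMap L (PadicAlgCl p)).comp (intermediateFieldIntegers p L).subtype).comp A.subtype) (rA g) = P⁻¹ * r g * P) :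
    haveI := ResidueRestrict.isLocalRing L κ hA; Deformation.IsAdicContinuous rA := by
  haveI := ResidueRestrict.isLocalRing L κ hA
  exact isAdicContinuous_of_le rA (fun m => (maximalIdeal (intermediateFieldIntegers p L) ^ (m + 1)).comap A.subtype)
    (fun _ _ hx => ResidueRestrict.mem_pow_of_coe_mem_pow_succ L κ hA hx)
    (fun m => isOpen_ker_mod_comap_pow L A rA r P hconj m)

/-- **An `𝒪_L`-lattice of `r` with reduction `κ ∘ ρ̄_𝒟` is a type-`𝒟` point.**  Let `𝒟` be a residual datum
over `(𝒪, k)`, `L/ℚ_p` finite inside `ℚ̄_p` with integers `𝒪_L` and residue field `k_L`, `ι : 𝒪 → 𝒪_L` and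
`κ : k → k_L` compatible coefficient maps (`κ ∘ (𝒪 → k) = residue ∘ ι`), and `r_L : Γ_F → GL₂(𝒪_L)` a lattice
of `r` (`𝒪_L ⊆ ℚ̄_p` pushes `r_L` to a conjugate of `r`) whose reduction is `κ ∘ ρ̄_𝒟` ON THE NOSE, unramified
outside `𝒟.S`, and upper triangular at every `v ∣ p` in a frame `P_L ≡ κ(frame v) mod λ_L`.  Then over the
residue-restricted ring `A = 𝒪_L ×_{k_L} k` (`…SeedPatchingPrimeResidueRestrict.lean`: a test ring of the
interface with residue field `k`, `𝒪`-algebra through `ι`) `r_L` descends to a deformation `r_A` OF TYPE `𝒟`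
(continuity is automatic: `r_L ~ r` is continuous and `𝔪_L^{m+1} ∩ A ⊆ 𝔪_A^m`), pushed by `A ⊆ 𝒪_L` to the same
conjugate of `r` — i.e. exactly the hypothesis of `stub_seedPatchingPrime_auxOfTypeD`. [cite: Mazur1997Deformation, §10] -/
theorem exists_isDeformation_of_lattice (𝒟 : NearlyOrdinaryDatum F p 𝒪 k)
    (ι : 𝒪 →+* intermediateFieldIntegers p L) (κ : k →+* IsLocalRing.ResidueField (intermediateFieldIntegers p L))
    (hικ : ∀ o, κ (algebraMap 𝒪 k o) = residue (intermediateFieldIntegers p L) (ι o))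
    (rL : absoluteGaloisGroup F →* GL (Fin 2) (intermediateFieldIntegers p L))
    (hres : (Matrix.GeneralLinearGroup.map (residue (intermediateFieldIntegers p L))).comp rL =
      (Matrix.GeneralLinearGroup.map κ).comp 𝒟.residual)
    (hunr : ∀ v ∉ 𝒟.S, Deformation.IsUnramifiedAt v rL)
    (hno : ∀ v : HeightOneSpectrum (𝓞 F), (p : 𝓞 F) ∈ v.asIdeal → ∃ PL : GL (Fin 2) (intermediateFieldIntegers p L),
        Matrix.GeneralLinearGroup.map (residue (intermediateFieldIntegers p L)) PL = Matrix.GeneralLinearGroup.map κ (𝒟.frame v) ∧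
        ∀ σ, (PL⁻¹ * rL (absGaloisRestrict F (v.adicCompletion F) σ) * PL).val 1 0 = 0)
    (r : FramedGaloisRep F (PadicAlgCl p) 2) (P : GL (Fin 2) (PadicAlgCl p))
    (hconj : ∀ g, Matrix.GeneralLinearGroup.map
      ((algebraMap L (PadicAlgCl p)).comp (intermediateFieldIntegers p L).subtype) (rL g) = P⁻¹ * r g * P) :
    ∃ (A : Type) (_ : CommRing A) (_ : IsLocalRing A) (_ : IsNoetherianRing A) (_ : Algebra 𝒪 A)
      (_ : IsAdicComplete (IsLocalRing.maximalIdeal A) A) (πA : A →ₐ[𝒪] k) (_ : Function.Surjective πA)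
      (rA : absoluteGaloisGroup F →* GL (Fin 2) A) (_ : 𝒟.IsDeformation πA rA)
      (j : A →+* (intermediateFieldIntegers p L)) (P' : GL (Fin 2) (PadicAlgCl p)),
      ∀ g, Matrix.GeneralLinearGroup.map
        (((algebraMap L (PadicAlgCl p)).comp (intermediateFieldIntegers p L).subtype).comp j) (rA g) =
          P'⁻¹ * r g * P' := by
  classical
  -- the test ring `A = 𝒪_L ×_{k_L} k` (an opaque subring with its membership characterisation)
  obtain ⟨A, hA⟩ : ∃ A : Subring (intermediateFieldIntegers p L), ∀ a : intermediateFieldIntegers p L,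
      a ∈ A ↔ ∃ y : k, κ y = residue (intermediateFieldIntegers p L) a :=
    ⟨_, fun a => ResidueRestrict.mem_comap_range_iff L κ⟩
  haveI := ResidueRestrict.isLocalRing L κ hA
  haveI := ResidueRestrict.isNoetherianRing L κ hA
  haveI := ResidueRestrict.isAdicComplete L κ hA
  obtain ⟨π, hπsurj, hπ⟩ := ResidueRestrict.exists_lift L κ hA
  -- the `𝒪`-algebra structure and the augmentation
  letI alg : Algebra 𝒪 A := (ι.codRestrict A fun o => (hA _).2 ⟨_, hικ o⟩).toAlgebra
  have halg : ∀ o, ((algebraMap 𝒪 A o : A) : (intermediateFieldIntegers p L)) = ι o := fun _ => rfl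
  let πA : A →ₐ[𝒪] k :=
    { π with
      commutes' := fun o => κ.injective (by
        change κ (π (algebraMap 𝒪 A o)) = κ (algebraMap 𝒪 k o)
        rw [hπ, halg, hικ]) }
  have hπA : ∀ a : A, κ (πA a) = residue (intermediateFieldIntegers p L) (a : (intermediateFieldIntegers p L)) := hπ
  have hκπ : κ.comp (πA : A →+* k) = (residue (intermediateFieldIntegers p L)).comp A.subtype := RingHom.ext hπA
  have hπAsurj : Function.Surjective πA := hπsurj
  -- descent of `rL` to `A`
  have hent : ∀ g i j, (rL g).val i j ∈ A.subtype.range := fun g i j => by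
    refine RingHom.mem_range.2 ⟨⟨(rL g).val i j, (hA _).2 ⟨(𝒟.residual g).val i j, ?_⟩⟩, rfl⟩
    have h := DFunLike.congr_fun hres g
    rw [MonoidHom.comp_apply, MonoidHom.comp_apply] at h
    have hij := congrArg (fun M : GL (Fin 2) (IsLocalRing.ResidueField (intermediateFieldIntegers p L)) => M.val i j) h
    simp only [Matrix.GeneralLinearGroup.map_apply] at hij
    exact hij.symm
  obtain ⟨rA, hrA⟩ := OrientedDatum.exists_hom_of_forall_mem_range A.subtype Subtype.val_injective rL hent
  have hinjA := Deformation.generalLinearGroup_map_injective (n := Fin 2) A.subtype Subtype.val_injective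
  have hinjκ := Deformation.generalLinearGroup_map_injective (n := Fin 2) κ κ.injective
  -- (a) continuity (automatic, `isAdicContinuous_of_conj`)
  have hconjA : ∀ g, Matrix.GeneralLinearGroup.map
      (((algebraMap L (PadicAlgCl p)).comp (intermediateFieldIntegers p L).subtype).comp A.subtype) (rA g) =
        P⁻¹ * r g * P := fun g => by
    rw [Matrix.GeneralLinearGroup.map_comp, MonoidHom.comp_apply, hrA g, hconj g]
  have hcont : Deformation.IsAdicContinuous rA := isAdicContinuous_of_conj L κ hA rA r P hconjA
  -- (b)–(d) the deformation conditions
  have hdef : 𝒟.IsDeformation πA rA := by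
    refine ⟨⟨hcont, MonoidHom.ext fun g => hinjκ ?_, fun v hv 𝔓 h𝔓 σ hσ => hinjA ?_⟩, fun v hv => ?_⟩
    · -- residual representation
      change Matrix.GeneralLinearGroup.map κ (Matrix.GeneralLinearGroup.map (πA : A →+* k) (rA g)) =
        Matrix.GeneralLinearGroup.map κ (𝒟.residual g)
      rw [← Matrix.GeneralLinearGroup.map_comp_apply, ← Matrix.GeneralLinearGroup.map_comp, hκπ,
        Matrix.GeneralLinearGroup.map_comp, Matrix.GeneralLinearGroup.map_comp_apply, hrA g]
      have h := DFunLike.congr_fun hres g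
      rwa [MonoidHom.comp_apply, MonoidHom.comp_apply] at h
    · -- unramified outside `S`
      rw [hrA, hunr v hv 𝔓 h𝔓 σ hσ, map_one]
    · -- nearly ordinary at `v ∣ p` with the residual line of `𝒟`
      obtain ⟨PL, hPL, hup⟩ := hno v hv
      have hPLinv : Matrix.GeneralLinearGroup.map (residue (intermediateFieldIntegers p L)) PL⁻¹ =
          Matrix.GeneralLinearGroup.map κ (𝒟.frame v)⁻¹ := by
        rw [map_inv, map_inv, hPL]
      obtain ⟨PA, hPA⟩ := exists_gl_map_eq A.subtype Subtype.val_injective PL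
        (fun i j => RingHom.mem_range.2
          ⟨⟨PL.val i j, (hA _).2 ⟨(𝒟.frame v).val i j, by
            have := congrArg (fun M : GL (Fin 2) (IsLocalRing.ResidueField (intermediateFieldIntegers p L)) => M.val i j) hPL
            simp only [Matrix.GeneralLinearGroup.map_apply] at this
            exact this.symm⟩⟩, rfl⟩)
        (fun i j => RingHom.mem_range.2
          ⟨⟨(PL⁻¹).val i j, (hA _).2 ⟨((𝒟.frame v)⁻¹).val i j, by
            have := congrArg (fun M : GL (Fin 2) (IsLocalRing.ResidueField (intermediateFieldIntegers p L)) => M.val i j) hPLinv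
            simp only [Matrix.GeneralLinearGroup.map_apply] at this
            exact this.symm⟩⟩, rfl⟩)
      have hframe : Matrix.GeneralLinearGroup.map (πA : A →+* k) PA = 𝒟.frame v :=
        hinjκ (by
          rw [← Matrix.GeneralLinearGroup.map_comp_apply, ← Matrix.GeneralLinearGroup.map_comp, hκπ,
            Matrix.GeneralLinearGroup.map_comp, Matrix.GeneralLinearGroup.map_comp_apply, hPA, hPL])
      refine ⟨PA, ?_, fun σ => ?_⟩
      · rw [hframe, inv_mul_cancel, Units.val_one, Matrix.one_apply_ne (by decide)]
      · have h2 : (((PA⁻¹ * rA (absGaloisRestrict F (v.adicCompletion F) σ) * PA).val 1 0 : A) :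
            intermediateFieldIntegers p L) =
            (PL⁻¹ * rL (absGaloisRestrict F (v.adicCompletion F) σ) * PL).val 1 0 := by
          rw [← hPA, ← hrA, ← map_inv, ← map_mul, ← map_mul]
          rfl
        exact Subtype.ext (h2.trans (hup σ))
  -- assemble
  exact ⟨A, inferInstance, inferInstance, inferInstance, alg, inferInstance, πA, hπAsurj, rA, hdef, A.subtype, P, hconjA⟩

end Lattice

/-! ## 3. The seed's `r` is unramified outside `S♯ ∪ {q}`; the registered lattice-level form of (P2) -/

section Seed

variable {F : Type} [Field F] [NumberField F] {p : ℕ} [Fact p.Prime]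

/-- **Level control: the seed's `r` is unramified outside `S♯ ∪ {q}`.**  For `v ∉ baseLevel ρ ∪ {q}` (`v ∤ p`,
`ρ` unramified at `v`, `v ≠ q`): the integral model `ρ₀ ↦ ρ` is trivial on the inertia at `v`, so its diagonal
is residually trivial there, so `v ∉ 𝒰.bad` by the seed's level clause, so `r` — associated with a point of
`𝕋(𝒰)` — is unramified at `v`. [folklore] -/
theorem isUnramifiedAt_of_seedData {O : ValuationSubring (PadicAlgCl p)} {ρ : FramedGaloisRep F (PadicAlgCl p) 2}
    {ρ₀ : absoluteGaloisGroup F →* GL (Fin 2) O} (hint : ρ.HasUpperTriangularIntegralModel ρ₀)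
    {𝒰 : TameLevel 2 F p} {r : FramedGaloisRep F (PadicAlgCl p) 2} {r₀ : absoluteGaloisGroup F →* GL (Fin 2) O}
    {q : HeightOneSpectrum (𝓞 F)} (hseed : SeedData p ρ₀ 𝒰 r r₀ q) {v : HeightOneSpectrum (𝓞 F)}
    (hv : v ∉ baseLevel ρ ∪ {q}) : r.IsUnramifiedAt v := by
  simp only [baseLevel, Set.mem_union, Set.mem_setOf_eq, Set.mem_singleton_iff, not_or, not_not] at hv
  obtain ⟨⟨hvp, hvρ⟩, hvq⟩ := hv
  obtain ⟨hmap, -⟩ := (FramedRep.hasUpperTriangularIntegralModel_two_iff _ ρ₀).1 hint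
  have hbad : v ∉ 𝒰.bad := by
    refine hseed.2.2.2.2.2 v hvq hvp fun 𝔓 h𝔓 σ hσ => ?_
    have h1 : ρ σ = 1 := hvρ 𝔓 h𝔓 σ hσ
    have h0 : ρ₀ σ = 1 :=
      Deformation.generalLinearGroup_map_injective O.subtype Subtype.val_injective (by rw [hmap, h1, map_one])
    rw [h0, Units.val_one, Matrix.one_apply_eq, Matrix.one_apply_eq, sub_self]
    exact ⟨Ideal.zero_mem _, Ideal.zero_mem _⟩
  obtain ⟨x, -, hass⟩ := hseed.2.1
  exact (hass v hbad).1

/-- **The lattice `r_L` of the seed's `r` is unramified outside the model's level** `M.𝒟.S = S♯ ∪ {q}`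
(injectivity of `GL₂(𝒪_L) → GL₂(ℚ̄_p)` and `isUnramifiedAt_of_seedData`). [folklore] -/
theorem isUnramifiedAt_lattice_of_seedData {O : ValuationSubring (PadicAlgCl p)}
    {ρ : FramedGaloisRep F (PadicAlgCl p) 2} {ρ₀ : absoluteGaloisGroup F →* GL (Fin 2) O}
    (hint : ρ.HasUpperTriangularIntegralModel ρ₀) {𝒰 : TameLevel 2 F p} {r : FramedGaloisRep F (PadicAlgCl p) 2}
    {r₀ : absoluteGaloisGroup F →* GL (Fin 2) O} {q : HeightOneSpectrum (𝓞 F)} (hseed : SeedData p ρ₀ 𝒰 r r₀ q)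
    {M : ModelData F p} (hM : M.Models ρ ρ₀ (baseLevel ρ ∪ {q}))
    (L : IntermediateField ℚ_[p] (PadicAlgCl p)) (rL : absoluteGaloisGroup F →* GL (Fin 2) (intermediateFieldIntegers p L))
    (P : GL (Fin 2) (PadicAlgCl p))
    (hconj : ∀ g, Matrix.GeneralLinearGroup.map
      ((algebraMap L (PadicAlgCl p)).comp (intermediateFieldIntegers p L).subtype) (rL g) = P⁻¹ * r g * P) :
    ∀ v ∉ M.𝒟.S, Deformation.IsUnramifiedAt v rL := by
  intro v hv 𝔓 h𝔓 σ hσ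
  rw [hM.S_eq] at hv
  have h1 : r σ = 1 := isUnramifiedAt_of_seedData hint hseed hv 𝔓 h𝔓 σ hσ
  refine Deformation.generalLinearGroup_map_injective
    ((algebraMap L (PadicAlgCl p)).comp (intermediateFieldIntegers p L).subtype)
    (fun _ _ h => Subtype.ext (Subtype.ext h)) ?_
  rw [hconj, h1, map_one, mul_one, inv_mul_cancel]

/-- **Registered sub-goal `stub_seedPatchingPrime_auxOfLattice` of stub (P2) `stub_seedPatchingPrime`
(line `fine-selmer-codimension-two`, crux stmt-Langlands-12919): the LATTICE-LEVEL form.**  The registered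
signature of (P2), verbatim, with ONE extra hypothesis inserted before the conclusion — the seed's `r` has an
`𝒪_L`-lattice OF RESIDUAL TYPE `M.𝒟`: for some finite `L/ℚ_p` inside `ℚ̄_p`, coefficient maps
`ι : M.𝒪 → 𝒪_L`, `κ : M.k → k_L` with `κ ∘ (M.𝒪 → M.k) = residue ∘ ι`, and a homomorphism
`r_L : Γ_F → GL₂(𝒪_L)` conjugate to `r` in `GL₂(ℚ̄_p)`, whose reduction is `κ ∘ ρ̄_{M.𝒟}` ON THE NOSE and which is
upper triangular at each `v ∣ p` in a frame `≡ κ(M.𝒟.frame v)`.  Then `R_𝒟 = M.𝓡.R` has a patching prime which is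
pro-modular.  Proof: `r_L` is unramified outside `M.𝒟.S = S♯ ∪ {q}` by the seed's level control
(`isUnramifiedAt_lattice_of_seedData`), descends to a deformation of type `M.𝒟` over `𝒪_L ×_{k_L} M.k`
(`exists_isDeformation_of_lattice`), and the landed `exists_isPatchingPrime_of_seedData_of_isDeformation`
(universality + automatic integrality + realised sub-case) concludes.  What is left of (P2) as registered is the
RESIDUAL statement producing `(L, ι, κ, r_L)`: Skinner–Wiles' transport of the extension class [SW, Prop. 4.2]
(or residual uniqueness in the unique-class regime). [cite: SkinnerWiles1999, §4.4] -/
theorem stub_seedPatchingPrime_auxOfLattice :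
    ∀ (F : Type) [Field F] [NumberField F], IsTotallyComplex F → Module.finrank ℚ F = 2 →
      ∀ (p : ℕ) [Fact p.Prime], p ≠ 2 →
      ∀ (O : ValuationSubring (PadicAlgCl p)),
        O = (Valued.v : Valuation (PadicAlgCl p) NNReal).valuationSubring →
      ∀ (ρ : FramedGaloisRep F (PadicAlgCl p) 2) (ρ₀ : absoluteGaloisGroup F →* GL (Fin 2) O),
        ρ.toGaloisRep.IsIrreducible → (∀ᶠ v in cofinite, ρ.IsUnramifiedAt v) →
        ρ.HasUpperTriangularIntegralModel ρ₀ → OrdLoc p O ρ ρ₀ →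
      ∀ (𝒰 : TameLevel 2 F p) (r : FramedGaloisRep F (PadicAlgCl p) 2)
        (r₀ : absoluteGaloisGroup F →* GL (Fin 2) O) (q : HeightOneSpectrum (𝓞 F)), SeedData p ρ₀ 𝒰 r r₀ q →
      ∀ M : ModelData F p, M.Models ρ ρ₀ (baseLevel ρ ∪ {q}) → M.IsLocalPoint → SmallReducibleLocus M.𝓡 →
        (∃ (L : IntermediateField ℚ_[p] (PadicAlgCl p)) (_ : FiniteDimensional ℚ_[p] L)
            (ι : M.𝒪 →+* intermediateFieldIntegers p L)
            (κ : M.k →+* IsLocalRing.ResidueField (intermediateFieldIntegers p L))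
            (_ : ∀ o, κ (algebraMap M.𝒪 M.k o) = IsLocalRing.residue (intermediateFieldIntegers p L) (ι o))
            (rL : absoluteGaloisGroup F →* GL (Fin 2) (intermediateFieldIntegers p L)) (P : GL (Fin 2) (PadicAlgCl p)),
            (Matrix.GeneralLinearGroup.map (IsLocalRing.residue (intermediateFieldIntegers p L))).comp rL =
                (Matrix.GeneralLinearGroup.map κ).comp M.𝒟.residual ∧
            (∀ v : HeightOneSpectrum (𝓞 F), (p : 𝓞 F) ∈ v.asIdeal →
              ∃ PL : GL (Fin 2) (intermediateFieldIntegers p L),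
                Matrix.GeneralLinearGroup.map (IsLocalRing.residue (intermediateFieldIntegers p L)) PL =
                  Matrix.GeneralLinearGroup.map κ (M.𝒟.frame v) ∧
                ∀ σ, (PL⁻¹ * rL (absGaloisRestrict F (v.adicCompletion F) σ) * PL).val 1 0 = 0) ∧
            ∀ g, Matrix.GeneralLinearGroup.map
              ((algebraMap L (PadicAlgCl p)).comp (intermediateFieldIntegers p L).subtype) (rL g) = P⁻¹ * r g * P) →
        ∃ 𝔭 : PrimeSpectrum M.𝓡.R, IsPatchingPrime M.𝓡 𝔭 ∧ IsProModularPrime M.𝓡 𝔭 := by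
  intro F _ _ _ _ p _ _ O _ ρ ρ₀ _ _ hint _ 𝒰 r r₀ q hseed M hM _ _ hT
  obtain ⟨L, hL, ι, κ, hικ, rL, P, hres, hno, hconj⟩ := hT
  haveI := hL
  obtain ⟨A, _, _, _, _, _, πA, hπA, rA, hdef, j, P', hP'⟩ :=
    exists_isDeformation_of_lattice L M.𝒟 ι κ hικ rL hres
      (isUnramifiedAt_lattice_of_seedData hint hseed hM L rL P hconj) hno r P hconj
  exact exists_isPatchingPrime_of_seedData_of_isDeformation hseed M A πA hπA rA hdef L j P' hP'

end Seed


end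

end Summit.Langlands.Langlands.Cruxes.ReducibleOrdinaryProModular.FineSelmerCodimensionTwo
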